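import Literature.Computability.QuantumComplexity.AaronsonAmbainis
import Literature.Computability.QuantumComplexity.InfluenceBounds
import Literature.Computability.QuantumComplexity.PolynomialMethod
import Literature.Computability.Complexity.BooleanFourier
import HarnessLib

/-!
# Aaronson–Ambainis, Theorem 7 (i): the influence conjecture implies classical simulability

Discharge of the named fact `AaronsonAmbainis2014_thm7` of `AaronsonAmbainis.lean`
(`AAConjecture → QuantumQuerySimulable`), following S. Aaronson, A. Ambainis, *The need for
structure in quantum speedups*, Theory of Computing 10 (2014) 133–166, §3, proof of Theorem 3.3
(= Thm. 1.8 (i) there = Thm. 7 (i) of arXiv:0911.0996v3), with its Lemma 3.1 (folklore bound on the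
total influence of a bounded low-degree polynomial) and Lemma 3.2 (Beals et al.: the acceptance
probability of a `T`-query algorithm is a real polynomial of degree `≤ 2T`, in the tree as
`exists_acceptPolynomial` / `QQueryAlg.acceptProb_le_one'`, file `PolynomialMethod.lean`).

## The printed proof (ToC version, pp. 152–154) and its rendering

* **Lemma 3.1.** `Inf[p] := Σᵢ Infᵢ[p] ≤ d` for a degree-`d` real polynomial with `0 ≤ p ≤ 1` on
  the cube, via the Fourier expansion (`Infᵢ[p] = 4 Σ_{S ∋ i} p̂(S)²` in the tree's normalisation
  of `influence`, `p̂(S) = 0` for `|S| > deg p`, Parseval). The tree's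
  `Literature/Computability/QuantumComplexity/InfluenceBounds.lean` proves exactly this toolkit
  (`walsh_flipBit`, `sum_flipBit`, `cubeFourierCoeff_evalBool_eq_zero`,
  `influence_eq_sum_sq_fourier`, and `sum_influence_le : Σᵢ Infᵢ[p] ≤ 4d`), on top of the
  Fourier–Walsh infrastructure of `Literature/Computability/Complexity/BooleanFourier.lean`; we use
  it as is (the cruder constant `4d` instead of the printed `d` only changes universal constants).
* **The algorithm `C`** (`simTree θ w D p`, a `RealDecisionTree`): with `p₀ := p`, repeat — if
  `Var[p_j] ≤ θ := ε²δ/2` output `E[p_j]` and halt; else the conjecture gives a variable with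
  `Infᵢ[p_j] ≥ w := C (θ/d)^c` (`pickVar`), query it and pass to the restriction
  `p_{j+1} := p_j|_{xᵢ := answer}` (`restrictPoly`, degree does not increase, values stay in `[0,1]`).
  We run it with a fuel/depth budget `D` (forced output `E[p_j]` when the budget is exhausted).
* **Analysis** (uniform `X`). (a) At a halting leaf, Chebyshev ("Markov") gives
  `Pr[|p_j(X) - E p_j| > ε] ≤ Var[p_j]/ε² ≤ δ/2` (inputs whose path halts before the
  budget and err by `> ε` number `≤ 2^N θ/ε²`, `haltError_simTree_le`). (b) The potential `Inf[p_j]`: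
  `E_{xᵢ}[Inf[p_{j+1}]] = ½ (Inf[p|₀] + Inf[p|₁]) = Σ_{i' ≠ i} Inf_{i'}[p_j] = Inf[p_j] - Infᵢ[p_j]
  ≤ Inf[p_j] - w` (`sum_influence_restrictPoly_add`), whence `w · E[#queries] ≤ Inf[p₀] ≤ 4d`
  (`sum_cost_simTree_mul_le`) and, by Markov, the inputs exhausting the budget `D` number `≤ 2^N · 4d/(w D)`
  (`RealDecisionTree.markov_cost`). With `D := ⌈8d/(wδ)⌉` both failure counts are `≤ δ 2^N / 2`. (c) `D` and hence
  the number of queries is `poly(T, 1/ε, 1/δ)`: with `d = 2T`, `u := T/(εδ) + 1`,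
  `D ≤ (16·4^c/C) u^{4c+2} + 1` (`queryBudget_arith`); the constants of `QuantumQuerySimulable` are
  `C' := ⌈16·2^c·2^c/C⌉₊ + 1`, `k := 4c + 2`, where `c, C` are the constants of `AAConjecture`.
  The case `T = 0` (constant acceptance probability) is a single leaf.
* "Since `X` is uniformly random, `xᵢ` will be `0` or `1` with equal probability, even conditioned on
  the results of all previous queries": rendered by keeping every restricted polynomial as an
  `N`-variate polynomial that ignores the queried variables, so that all expectations remain
  full-cube averages, and by the flip-invariance of subtrees built from such polynomials
  (`simTree_flipBit`: a variable of influence `0 < w` is never queried again), which makes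
  conditioning on `xᵢ = b` an exact halving (`sum_ite_apply_eq_half`).

No new definitions of mathematical content beyond proof devices (`restrictPoly`,
`RealDecisionTree.cost`, and `pickVar`/`simTree` in the sub-namespace `ClassicalSimulation`
naming the algorithm `C`; `pickVar` chooses the LEAST influential index, `pickVar_eq_some_iff`,
so that `simTree` is a definite, machine-implementable algorithm — used by the Thm. 23 files
`AaronsonAmbainisSimTreeBounds.lean`, `AaronsonAmbainisThm23Queries.lean`); no named facts are
introduced.

## References

* S. Aaronson, A. Ambainis, *The need for structure in quantum speedups*, Theory Comput. 10
  (2014) 133–166, §3: Lemma 3.1, Lemma 3.2, Theorem 3.3 (pp. 152–154); arXiv:0911.0996v3, Thm. 7.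
  [AaronsonAmbainis2014]
* R. O'Donnell, *Analysis of Boolean Functions*, CUP 2014, §1.4 (Parseval), §2.2 (influences).
  [ODonnell2014]
* R. Beals, H. Buhrman, R. Cleve, M. Mosca, R. de Wolf, *Quantum lower bounds by polynomials*,
  J. ACM 48 (2001), Lemma 4.2. [BealsEtAl2001]
-/

noncomputable section

open Finset

namespace Literature.Computability.QuantumComplexity

open Cryptography
open Literature.Probability.RandomGraphs.LowDegree
open Literature.Computability.Complexity.LowDegree

variable {N : ℕ}

/-! ### Sums over the Boolean cube and bit flips -/

/-- Flipping bit `i` changes coordinate `i`. [folklore] -/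
@[simp] theorem flipBit_apply_self (i : Fin N) (x : Fin N → Bool) : flipBit i x i = !x i := by
  simp [flipBit]

/-- Flipping bit `i` does not change the other coordinates. [folklore] -/
theorem flipBit_apply_of_ne {i j : Fin N} (h : j ≠ i) (x : Fin N → Bool) : flipBit i x j = x j := by
  simp [flipBit, h]

/-- The cube has `2^N` points. [folklore] -/
theorem card_cube : (Finset.univ : Finset (Fin N → Bool)).card = 2 ^ N := by
  simp [Finset.card_univ, Fintype.card_fin, Fintype.card_bool]

/-- `∑_x c = 2^N c` on the cube. [folklore] -/
theorem sum_const_cube (c : ℝ) : ∑ _x : Fin N → Bool, c = 2 ^ N * c := by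
  rw [Finset.sum_const, card_cube, nsmul_eq_mul]
  push_cast
  ring

/-- `{x|ᵢ₌₀, x|ᵢ₌₁} = {x, xⁱ}` pointwise. [folklore] -/
theorem apply_update_false_add_apply_update_true (i : Fin N) (g : (Fin N → Bool) → ℝ)
    (x : Fin N → Bool) :
    g (Function.update x i false) + g (Function.update x i true) = g x + g (flipBit i x) := by
  cases h : x i
  · have h1 : Function.update x i false = x := by rw [← h, Function.update_eq_self]
    have h2 : Function.update x i true = flipBit i x := by simp [flipBit, h]
    rw [h1, h2]
  · have h1 : Function.update x i true = x := by rw [← h, Function.update_eq_self]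
    have h2 : Function.update x i false = flipBit i x := by simp [flipBit, h]
    rw [h1, h2, add_comm]

/-- Averaging the two restrictions of a coordinate recovers the full average:
`∑_x g(x|ᵢ₌₀) + ∑_x g(x|ᵢ₌₁) = 2 ∑_x g(x)`. [folklore] -/
theorem sum_update_add_sum_update (i : Fin N) (g : (Fin N → Bool) → ℝ) :
    ∑ x, g (Function.update x i false) + ∑ x, g (Function.update x i true) = 2 * ∑ x, g x := by
  rw [← Finset.sum_add_distrib, Finset.sum_congr rfl
    (fun x _ => apply_update_false_add_apply_update_true i g x), Finset.sum_add_distrib, sum_flipBit,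
    two_mul]

/-- A function invariant under flipping bit `i` has equal mass on the two half-cubes
`{xᵢ = b}`: `∑_{x : xᵢ = b} g(x) = ½ ∑_x g(x)`. [folklore] -/
theorem sum_ite_apply_eq_half (i : Fin N) (b : Bool) {g : (Fin N → Bool) → ℝ}
    (hg : ∀ x, g (flipBit i x) = g x) :
    ∑ x, (if x i = b then g x else 0) = (∑ x, g x) / 2 := by
  have h1 : ∑ x, (if x i = b then g x else 0) +
      ∑ x, (if (flipBit i x) i = b then g (flipBit i x) else 0) = ∑ x, g x := by
    rw [← Finset.sum_add_distrib]
    refine Finset.sum_congr rfl fun x _ => ?_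
    rw [flipBit_apply_self, hg]
    cases x i <;> cases b <;> simp
  have h2 : ∑ x, (if (flipBit i x) i = b then g (flipBit i x) else 0) =
      ∑ x, (if x i = b then g x else 0) :=
    sum_flipBit i (fun x => if x i = b then g x else 0)
  rw [h2] at h1
  linarith

/-- Updating coordinate `j` commutes with flipping a different coordinate `i`. [folklore] -/
theorem update_flipBit_comm {i j : Fin N} (h : i ≠ j) (x : Fin N → Bool) (b : Bool) :
    Function.update (flipBit i x) j b = flipBit i (Function.update x j b) := by
  funext k
  simp only [flipBit, Function.update_apply]
  by_cases hkj : k = j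
  · subst hkj
    simp [Ne.symm h]
  · by_cases hki : k = i
    · subst hki
      simp [h]
    · simp [hkj, hki]

/-! ### A degree-`0` polynomial is constant on the cube -/

/-- A polynomial of total degree `0` is constant on the cube: `p(x) = p̂(∅)`. [folklore] -/
theorem evalBool_eq_cubeFourierCoeff_empty (p : MvPolynomial (Fin N) ℝ) (hp : p.totalDegree = 0)
    (x : Fin N → Bool) : evalBool p x = cubeFourierCoeff (evalBool p) ∅ := by
  have h := sum_cubeFourierCoeff_mul_walsh (evalBool p) x
  rw [Finset.sum_eq_single ∅] at h
  · simpa using h.symm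
  · intro S _ hS
    rw [cubeFourierCoeff_evalBool_eq_zero hp.le
      (Finset.card_pos.mpr (Finset.nonempty_iff_ne_empty.mpr hS)), zero_mul]
  · simp

/-! ### Restricting a polynomial to `xᵢ := b` -/

/-- The restriction `p|_{xᵢ := b}`: substitute the constant `b ∈ {0,1}` for the variable `Xᵢ`
(kept as an `N`-variate polynomial, now independent of `Xᵢ`).
[cite: AaronsonAmbainis2014, Thm. 3.3 (proof)] -/
def restrictPoly (i : Fin N) (b : Bool) (p : MvPolynomial (Fin N) ℝ) : MvPolynomial (Fin N) ℝ :=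
  MvPolynomial.aeval
    (fun j => if j = i then MvPolynomial.C (if b then (1 : ℝ) else 0) else MvPolynomial.X j) p

/-- On the cube, `p|_{xᵢ := b}(x) = p(x with xᵢ := b)`. [cite: AaronsonAmbainis2014, Thm. 3.3 (proof)] -/
theorem evalBool_restrictPoly (i : Fin N) (b : Bool) (p : MvPolynomial (Fin N) ℝ)
    (x : Fin N → Bool) : evalBool (restrictPoly i b p) x = evalBool p (Function.update x i b) := by
  unfold evalBool restrictPoly
  induction p using MvPolynomial.induction_on with
  | C a => simp
  | add p q hp hq => simp only [map_add, hp, hq]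
  | mul_X p j hp =>
    simp only [map_mul, hp, MvPolynomial.aeval_X, MvPolynomial.eval_X]
    congr 1
    by_cases hj : j = i
    · subst hj
      simp
    · simp [hj]

/-- Substituting polynomials of degree `≤ 1` does not raise the total degree. (A private copy of
a lemma the tree proves several times — e.g. `totalDegree_bind₁_le_of_le_one` of
`BlockSensitivityQuantumBound.lean`, `totalDegree_aeval_le_of_forall_le_one` of
`AlgebraicComplexity/PowerSumNonvanishing.lean` — kept private here to avoid their heavier
imports.) [folklore] -/
private theorem totalDegree_aeval_le_of_forall_totalDegree_le_one {σ τ R : Type*} [CommSemiring R]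
    (φ : σ → MvPolynomial τ R) (hφ : ∀ i, (φ i).totalDegree ≤ 1) (F : MvPolynomial σ R) :
    (MvPolynomial.aeval φ F).totalDegree ≤ F.totalDegree := by
  classical
  rw [F.as_sum, map_sum]
  refine (MvPolynomial.totalDegree_finsetSum _ _).trans (Finset.sup_le fun e he => ?_)
  rw [MvPolynomial.aeval_monomial, MvPolynomial.algebraMap_eq]
  refine (MvPolynomial.totalDegree_mul _ _).trans ?_
  rw [MvPolynomial.totalDegree_C, zero_add, Finsupp.prod]
  refine (MvPolynomial.totalDegree_finsetProd _ _).trans ?_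
  refine le_trans (Finset.sum_le_sum fun i _ => (MvPolynomial.totalDegree_pow _ _).trans
    (Nat.mul_le_mul_left _ (hφ i))) ?_
  simp only [mul_one]
  rw [← F.as_sum]
  exact MvPolynomial.le_totalDegree he

/-- Restriction does not raise the total degree. [cite: AaronsonAmbainis2014, Thm. 3.3 (proof)] -/
theorem totalDegree_restrictPoly_le (i : Fin N) (b : Bool) (p : MvPolynomial (Fin N) ℝ) :
    (restrictPoly i b p).totalDegree ≤ p.totalDegree := by
  refine totalDegree_aeval_le_of_forall_totalDegree_le_one _ (fun j => ?_) p
  by_cases hj : j = i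
  · subst hj
    cases b <;> simp
  · simp only [hj, if_false]
    rw [MvPolynomial.totalDegree_X]

/-- Values of a restriction stay in `[0,1]` if those of `p` do. [folklore] -/
theorem restrictPoly_bound {p : MvPolynomial (Fin N) ℝ}
    (hbd : ∀ x, 0 ≤ evalBool p x ∧ evalBool p x ≤ 1) (i : Fin N) (b : Bool) :
    ∀ x, 0 ≤ evalBool (restrictPoly i b p) x ∧ evalBool (restrictPoly i b p) x ≤ 1 := fun x => by
  rw [evalBool_restrictPoly]
  exact hbd _

/-- A restriction at `i` is invariant under flipping bit `i`. [folklore] -/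
theorem evalBool_restrictPoly_flipBit (i : Fin N) (b : Bool) (p : MvPolynomial (Fin N) ℝ)
    (x : Fin N → Bool) :
    evalBool (restrictPoly i b p) (flipBit i x) = evalBool (restrictPoly i b p) x := by
  rw [evalBool_restrictPoly, evalBool_restrictPoly]
  simp [flipBit]

/-- The restricted polynomial has no influence in the restricted variable. [folklore] -/
theorem influence_restrictPoly_self (i : Fin N) (b : Bool) (p : MvPolynomial (Fin N) ℝ) :
    influence i (restrictPoly i b p) = 0 := by
  unfold influence boolAvg
  simp [evalBool_restrictPoly_flipBit]

/-- **The expected influence after a query is the influence before**: for `j ≠ i`,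
`Inf_j[p|_{xᵢ=0}] + Inf_j[p|_{xᵢ=1}] = 2 Inf_j[p]`. [cite: AaronsonAmbainis2014, Thm. 3.3 (proof)] -/
theorem influence_restrictPoly_add {i j : Fin N} (h : j ≠ i) (p : MvPolynomial (Fin N) ℝ) :
    influence j (restrictPoly i false p) + influence j (restrictPoly i true p) =
      2 * influence j p := by
  unfold influence boolAvg
  simp_rw [evalBool_restrictPoly]
  set g : (Fin N → Bool) → ℝ := fun y => (evalBool p y - evalBool p (flipBit j y)) ^ 2 with hg
  have key : ∀ b : Bool, ∑ x, (evalBool p (Function.update x i b) -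
      evalBool p (Function.update (flipBit j x) i b)) ^ 2 = ∑ x, g (Function.update x i b) :=
    fun b => Finset.sum_congr rfl fun x _ => by rw [update_flipBit_comm h, hg]
  rw [← add_div, key, key, sum_update_add_sum_update i g]
  ring

/-- **The potential drops by the queried influence**:
`Inf[p|_{xᵢ=0}] + Inf[p|_{xᵢ=1}] = 2 (Inf[p] - Infᵢ[p])` ("`E_{xᵢ}[Inf[p_{j+1}]] = Σ_{i' ≠ i} Inf_{i'}[p_j]
= Inf[p_j] - Inf_{i}[p_j]`"). [cite: AaronsonAmbainis2014, Thm. 3.3 (proof)] -/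
theorem sum_influence_restrictPoly_add (i : Fin N) (p : MvPolynomial (Fin N) ℝ) :
    ∑ j, influence j (restrictPoly i false p) + ∑ j, influence j (restrictPoly i true p) =
      2 * (∑ j, influence j p - influence i p) := by
  rw [← Finset.sum_add_distrib]
  calc ∑ j, (influence j (restrictPoly i false p) + influence j (restrictPoly i true p))
      = (influence i (restrictPoly i false p) + influence i (restrictPoly i true p)) +
          ∑ j ∈ Finset.univ.erase i,
            (influence j (restrictPoly i false p) + influence j (restrictPoly i true p)) :=
        (Finset.add_sum_erase _ _ (Finset.mem_univ i)).symm
    _ = ∑ j ∈ Finset.univ.erase i, 2 * influence j p := by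
        rw [influence_restrictPoly_self, influence_restrictPoly_self, zero_add, zero_add]
        exact Finset.sum_congr rfl fun j hj => influence_restrictPoly_add (Finset.ne_of_mem_erase hj) p
    _ = 2 * (∑ j, influence j p - influence i p) := by
        rw [← Finset.mul_sum, Finset.sum_erase_eq_sub (Finset.mem_univ i)]

/-! ### The simulating decision tree -/

namespace RealDecisionTree

/-- The number of queries the tree makes on input `x` (the length of `x`'s path).
[cite: AaronsonAmbainis2014, Thm. 3.3 (proof: "each iteration queries exactly one variable")] -/
def cost : RealDecisionTree N → (Fin N → Bool) → ℕ
  | leaf _, _ => 0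
  | query i t₀ t₁, x => (if x i then t₁.cost x else t₀.cost x) + 1

/-- A leaf makes no queries. [folklore] -/
@[simp] theorem cost_leaf (r : ℝ) (x : Fin N → Bool) : (leaf r : RealDecisionTree N).cost x = 0 :=
  rfl

/-- The cost of a query node. [folklore] -/
@[simp] theorem cost_query (i : Fin N) (t₀ t₁ : RealDecisionTree N) (x : Fin N → Bool) :
    (query i t₀ t₁).cost x = (if x i then t₁.cost x else t₀.cost x) + 1 := rfl

/-- The output of a query node. [folklore] -/
@[simp] theorem eval_query (i : Fin N) (t₀ t₁ : RealDecisionTree N) (x : Fin N → Bool) :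
    (query i t₀ t₁).eval x = if x i then t₁.eval x else t₀.eval x := rfl

/-- The depth of a query node. [folklore] -/
@[simp] theorem depth_query (i : Fin N) (t₀ t₁ : RealDecisionTree N) :
    (query i t₀ t₁).depth = max t₀.depth t₁.depth + 1 := rfl

/-- **Markov's inequality for the number of queries**: `D · #{x : #queries(x) = D} ≤ ∑_x #queries(x)`.
[cite: AaronsonAmbainis2014, Thm. 3.3 (proof)] -/
theorem markov_cost (t : RealDecisionTree N) (D : ℕ) :
    (D : ℝ) * ∑ x, (if t.cost x = D then (1 : ℝ) else 0) ≤ ∑ x, (t.cost x : ℝ) := by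
  rw [Finset.mul_sum]
  refine Finset.sum_le_sum fun x _ => ?_
  split_ifs with h
  · rw [← h]; simp
  · simp

end RealDecisionTree

namespace ClassicalSimulation

open scoped Classical in
/-- The choice of the variable to query: the LEAST `i` with `Infᵢ[p] ≥ w`, if there is one ("find
an `i` such that `Infᵢ[p_j] > w(ε²δ/2T)`"). The least index (`Fin.find`) rather than an
arbitrary one (`Classical.choose`), so that the simulation is a definite algorithm that a machine
can implement — as needed for the polynomial-TIME version of the simulation in the proof of
Thm. 23 ("finding an `i` such that `Inf_i[p_j] > q(ε²/T)` is in the third level of the counting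
hierarchy", arXiv:0911.0996v3 p. 14); the analysis below only uses `le_influence_of_pickVar` and
`pickVar_ne_none`. [cite: AaronsonAmbainis2014, Thm. 3.3 (proof)] -/
def pickVar (w : ℝ) (p : MvPolynomial (Fin N) ℝ) : Option (Fin N) :=
  if h : ∃ i, w ≤ influence i p then some (Fin.find (fun i => w ≤ influence i p) h) else none

/-- The chosen variable is influential. [folklore] -/
theorem le_influence_of_pickVar {w : ℝ} {p : MvPolynomial (Fin N) ℝ} {i : Fin N}
    (h : pickVar w p = some i) : w ≤ influence i p := by
  classical
  unfold pickVar at h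
  split_ifs at h with h'
  injection h with h
  subst h
  exact Fin.find_spec (p := fun i => w ≤ influence i p) h'

/-- If an influential variable exists, one is chosen. [folklore] -/
theorem pickVar_ne_none {w : ℝ} {p : MvPolynomial (Fin N) ℝ} (h : ∃ i, w ≤ influence i p) :
    pickVar w p ≠ none := by
  classical
  unfold pickVar
  rw [dif_pos h]
  exact Option.some_ne_none _

/-- **The choice is canonical**: `pickVar w p = some i` iff `i` is the least index of influence
`≥ w`. [folklore] -/
theorem pickVar_eq_some_iff {w : ℝ} {p : MvPolynomial (Fin N) ℝ} {i : Fin N} :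
    pickVar w p = some i ↔ w ≤ influence i p ∧ ∀ j < i, ¬ w ≤ influence j p := by
  classical
  unfold pickVar
  split_ifs with h
  · rw [Option.some.injEq, Fin.find_eq_iff]
  · simp only [false_iff, not_and]
    exact fun hi _ => (h ⟨i, hi⟩).elim

/-- No variable is chosen iff none has influence `≥ w`. [folklore] -/
theorem pickVar_eq_none_iff {w : ℝ} {p : MvPolynomial (Fin N) ℝ} :
    pickVar w p = none ↔ ∀ i, ¬ w ≤ influence i p := by
  classical
  unfold pickVar
  split_ifs with h
  · simp only [false_iff, not_forall, not_not]; exact h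
  · simp only [true_iff]; exact fun i hi => h ⟨i, hi⟩

/-- **The classical simulation algorithm `C`** of Aaronson–Ambainis (Thm. 3.3) as a decision tree,
with variance threshold `θ`, influence threshold `w` and a budget of `D` queries: if `Var[p] ≤ θ`
(or the budget is exhausted, or — impossible under the conjecture — no variable has influence `≥ w`)
output `E[p]`; otherwise query an influential variable `i` and continue with `p|_{xᵢ := answer}`.
[cite: AaronsonAmbainis2014, Thm. 3.3 (proof)] -/
def simTree (θ w : ℝ) : ℕ → MvPolynomial (Fin N) ℝ → RealDecisionTree N
  | 0, p => .leaf (boolAvg (evalBool p))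
  | D + 1, p =>
    if boolVariance p ≤ θ then .leaf (boolAvg (evalBool p))
    else
      match pickVar w p with
      | none => .leaf (boolAvg (evalBool p))
      | some i => .query i (simTree θ w D (restrictPoly i false p))
          (simTree θ w D (restrictPoly i true p))

section SimTree

variable (θ w : ℝ)

/-- Halting step: small variance gives the leaf `E[p]`. [cite: AaronsonAmbainis2014, Thm. 3.3 (proof)] -/
theorem simTree_succ_of_le {D : ℕ} {p : MvPolynomial (Fin N) ℝ} (h : boolVariance p ≤ θ) :
    simTree θ w (D + 1) p = .leaf (boolAvg (evalBool p)) := by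
  simp [simTree, h]

/-- (Degenerate step, unreachable under the conjecture.) [folklore] -/
theorem simTree_succ_of_none {D : ℕ} {p : MvPolynomial (Fin N) ℝ} (h : ¬ boolVariance p ≤ θ)
    (hn : pickVar w p = none) : simTree θ w (D + 1) p = .leaf (boolAvg (evalBool p)) := by
  simp [simTree, h, hn]

/-- Query step. [cite: AaronsonAmbainis2014, Thm. 3.3 (proof)] -/
theorem simTree_succ_of_some {D : ℕ} {p : MvPolynomial (Fin N) ℝ} (h : ¬ boolVariance p ≤ θ)
    {i : Fin N} (hs : pickVar w p = some i) :
    simTree θ w (D + 1) p = .query i (simTree θ w D (restrictPoly i false p))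
      (simTree θ w D (restrictPoly i true p)) := by
  simp [simTree, h, hs]

/-- The tree makes at most `D` (budget) queries: depth `≤ D`. [cite: AaronsonAmbainis2014, Thm. 3.3 (proof)] -/
theorem depth_simTree_le : ∀ (D : ℕ) (p : MvPolynomial (Fin N) ℝ), (simTree θ w D p).depth ≤ D
  | 0, p => by simp [simTree]
  | D + 1, p => by
    by_cases h : boolVariance p ≤ θ
    · rw [simTree_succ_of_le θ w h]; simp
    · cases hp : pickVar w p with
      | none => rw [simTree_succ_of_none θ w h hp]; simp
      | some i =>
        rw [simTree_succ_of_some θ w h hp, RealDecisionTree.depth_query]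
        have h0 := depth_simTree_le D (restrictPoly i false p)
        have h1 := depth_simTree_le D (restrictPoly i true p)
        omega

/-- Every path has length `≤ D`. [folklore] -/
theorem cost_simTree_le : ∀ (D : ℕ) (p : MvPolynomial (Fin N) ℝ) (x : Fin N → Bool),
    (simTree θ w D p).cost x ≤ D
  | 0, p, x => by simp [simTree]
  | D + 1, p, x => by
    by_cases h : boolVariance p ≤ θ
    · rw [simTree_succ_of_le θ w h]; simp
    · cases hp : pickVar w p with
      | none => rw [simTree_succ_of_none θ w h hp]; simp
      | some i =>
        rw [simTree_succ_of_some θ w h hp, RealDecisionTree.cost_query]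
        have h0 := cost_simTree_le D (restrictPoly i false p) x
        have h1 := cost_simTree_le D (restrictPoly i true p) x
        cases x i <;> simp <;> omega

/-- **Queried variables are never queried again**: if `p` ignores `xᵢ` then so do the output and
the path length of the tree built from `p` (a variable of influence `0 < w` is not chosen, and
restrictions of `p` still ignore `xᵢ`). [cite: AaronsonAmbainis2014, Thm. 3.3 (proof)] -/
theorem simTree_flipBit (hw : 0 < w) (i : Fin N) :
    ∀ (D : ℕ) (p : MvPolynomial (Fin N) ℝ), (∀ x, evalBool p (flipBit i x) = evalBool p x) →
      ∀ x, (simTree θ w D p).eval (flipBit i x) = (simTree θ w D p).eval x ∧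
        (simTree θ w D p).cost (flipBit i x) = (simTree θ w D p).cost x
  | 0, p, _, x => by simp [simTree]
  | D + 1, p, hinv, x => by
    by_cases h : boolVariance p ≤ θ
    · rw [simTree_succ_of_le θ w h]; simp
    · cases hp : pickVar w p with
      | none => rw [simTree_succ_of_none θ w h hp]; simp
      | some j =>
        rw [simTree_succ_of_some θ w h hp]
        have hji : j ≠ i := by
          intro hji
          subst hji
          have h0 : influence j p = 0 := by
            unfold influence boolAvg
            simp [hinv]
          have := le_influence_of_pickVar hp
          linarith
        have hinv' : ∀ (b : Bool) (y : Fin N → Bool),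
            evalBool (restrictPoly j b p) (flipBit i y) = evalBool (restrictPoly j b p) y := by
          intro b y
          rw [evalBool_restrictPoly, evalBool_restrictPoly, update_flipBit_comm (Ne.symm hji)]
          exact hinv _
        have IH0 := simTree_flipBit hw i D (restrictPoly j false p) (hinv' false) x
        have IH1 := simTree_flipBit hw i D (restrictPoly j true p) (hinv' true) x
        simp only [RealDecisionTree.eval_query, RealDecisionTree.cost_query,
          flipBit_apply_of_ne hji]
        cases x j <;> simp [IH0.1, IH0.2, IH1.1, IH1.2]

variable (d : ℕ)

/-- **Expected number of queries** (the potential argument): under the conclusion of the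
conjecture for threshold `θ` ("`Infᵢ[p_j] ≥ w` whenever `Var[p_j] > θ`"), for bounded degree-`d`
polynomials `w · ∑_x #queries(x) ≤ 2^N · Inf[p]`, i.e. `E_X[#queries] ≤ Inf[p]/w`.
[cite: AaronsonAmbainis2014, Thm. 3.3 (proof)] -/
theorem sum_cost_simTree_mul_le (hw : 0 < w)
    (hAA : ∀ q : MvPolynomial (Fin N) ℝ, q.totalDegree ≤ d →
      (∀ x, 0 ≤ evalBool q x ∧ evalBool q x ≤ 1) → θ < boolVariance q → ∃ i, w ≤ influence i q) :
    ∀ (D : ℕ) (p : MvPolynomial (Fin N) ℝ), p.totalDegree ≤ d →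
      (∀ x, 0 ≤ evalBool p x ∧ evalBool p x ≤ 1) →
        (∑ x, ((simTree θ w D p).cost x : ℝ)) * w ≤ 2 ^ N * ∑ j, influence j p
  | 0, p, _, _ => by
    simp only [simTree, RealDecisionTree.cost_leaf, Nat.cast_zero, Finset.sum_const_zero, zero_mul]
    exact mul_nonneg (by positivity) (Finset.sum_nonneg fun j _ => influence_nonneg j p)
  | D + 1, p, hdeg, hbd => by
    by_cases h : boolVariance p ≤ θ
    · rw [simTree_succ_of_le θ w h]
      simp only [RealDecisionTree.cost_leaf, Nat.cast_zero, Finset.sum_const_zero, zero_mul]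
      exact mul_nonneg (by positivity) (Finset.sum_nonneg fun j _ => influence_nonneg j p)
    · cases hp : pickVar w p with
      | none => exact absurd hp (pickVar_ne_none (hAA p hdeg hbd (lt_of_not_ge h)))
      | some i =>
        rw [simTree_succ_of_some θ w h hp]
        set T0 := simTree θ w D (restrictPoly i false p) with hT0
        set T1 := simTree θ w D (restrictPoly i true p) with hT1
        have IH0 := sum_cost_simTree_mul_le hw hAA D (restrictPoly i false p)
          ((totalDegree_restrictPoly_le i false p).trans hdeg) (restrictPoly_bound hbd i false)
        have IH1 := sum_cost_simTree_mul_le hw hAA D (restrictPoly i true p)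
          ((totalDegree_restrictPoly_le i true p).trans hdeg) (restrictPoly_bound hbd i true)
        rw [← hT0] at IH0
        rw [← hT1] at IH1
        have hinv0 : ∀ x, (T0.cost (flipBit i x) : ℝ) = T0.cost x := fun x => by
          rw [(simTree_flipBit θ w hw i D (restrictPoly i false p)
            (evalBool_restrictPoly_flipBit i false p) x).2]
        have hinv1 : ∀ x, (T1.cost (flipBit i x) : ℝ) = T1.cost x := fun x => by
          rw [(simTree_flipBit θ w hw i D (restrictPoly i true p)
            (evalBool_restrictPoly_flipBit i true p) x).2]
        have hsplit : ∑ x : Fin N → Bool, (((if x i then T1.cost x else T0.cost x) + 1 : ℕ) : ℝ) =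
            (∑ x, (T0.cost x : ℝ)) / 2 + (∑ x, (T1.cost x : ℝ)) / 2 + 2 ^ N := by
          rw [← sum_ite_apply_eq_half i false hinv0, ← sum_ite_apply_eq_half i true hinv1,
            ← Finset.sum_add_distrib, ← mul_one ((2 : ℝ) ^ N), ← sum_const_cube,
            ← Finset.sum_add_distrib]
          refine Finset.sum_congr rfl fun x _ => ?_
          cases x i <;> simp
        have hkey : (2 : ℝ) ^ N * ∑ j, influence j (restrictPoly i false p) +
            2 ^ N * ∑ j, influence j (restrictPoly i true p) =
              2 ^ N * (2 * (∑ j, influence j p - influence i p)) := by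
          rw [← mul_add, sum_influence_restrictPoly_add]
        have hwi : (2 : ℝ) ^ N * w ≤ 2 ^ N * influence i p :=
          mul_le_mul_of_nonneg_left (le_influence_of_pickVar hp) (by positivity)
        simp only [RealDecisionTree.cost_query]
        rw [hsplit]
        nlinarith [IH0, IH1, hkey, hwi]

variable (ε : ℝ)

/-- **Correctness when halting** (Chebyshev at the halting leaves): the inputs whose path halts
within the budget and whose output errs by more than `ε` number at most `2^N θ / ε²`
("when `C` halts, `Var[p_j] ≤ θ`; by Markov's inequality `Pr[|p_j(X) - E[p_j]| > ε] < θ/ε²`").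
[cite: AaronsonAmbainis2014, Thm. 3.3 (proof)] -/
theorem haltError_simTree_le (hw : 0 < w) (hθ : 0 ≤ θ) (hε : 0 < ε)
    (hAA : ∀ q : MvPolynomial (Fin N) ℝ, q.totalDegree ≤ d →
      (∀ x, 0 ≤ evalBool q x ∧ evalBool q x ≤ 1) → θ < boolVariance q → ∃ i, w ≤ influence i q) :
    ∀ (D : ℕ) (p : MvPolynomial (Fin N) ℝ), p.totalDegree ≤ d →
      (∀ x, 0 ≤ evalBool p x ∧ evalBool p x ≤ 1) →
        (∑ x, if (simTree θ w D p).cost x < D ∧ ε < |(simTree θ w D p).eval x - evalBool p x|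
          then (1 : ℝ) else 0) * ε ^ 2 ≤ 2 ^ N * θ
  | 0, p, _, _ => by
    simp only [Nat.not_lt_zero, false_and, if_false, Finset.sum_const_zero, zero_mul]
    positivity
  | D + 1, p, hdeg, hbd => by
    by_cases h : boolVariance p ≤ θ
    · rw [simTree_succ_of_le θ w h]
      simp only [RealDecisionTree.cost_leaf, Nat.zero_lt_succ, true_and,
        RealDecisionTree.eval_leaf]
      calc (∑ x, if ε < |boolAvg (evalBool p) - evalBool p x| then (1 : ℝ) else 0) * ε ^ 2
          = ∑ x, (if ε < |boolAvg (evalBool p) - evalBool p x| then ε ^ 2 else 0) := by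
            rw [Finset.sum_mul]
            refine Finset.sum_congr rfl fun x _ => ?_
            split_ifs <;> simp
        _ ≤ ∑ x, (evalBool p x - boolAvg (evalBool p)) ^ 2 := by
            refine Finset.sum_le_sum fun x _ => ?_
            split_ifs with hx
            · have h1 : ε ^ 2 ≤ |boolAvg (evalBool p) - evalBool p x| ^ 2 :=
                pow_le_pow_left₀ hε.le hx.le 2
              rw [sq_abs] at h1
              nlinarith [h1]
            · positivity
        _ = 2 ^ N * boolVariance p := by
            have h2 : (2 : ℝ) ^ N ≠ 0 := by positivity
            have hmul : ∀ s : ℝ, 2 ^ N * (s / 2 ^ N) = s := fun s => mul_div_cancel₀ s h2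
            show _ = 2 ^ N * ((∑ x, (evalBool p x - boolAvg (evalBool p)) ^ 2) / 2 ^ N)
            rw [hmul]
        _ ≤ 2 ^ N * θ := by gcongr
    · cases hp : pickVar w p with
      | none => exact absurd hp (pickVar_ne_none (hAA p hdeg hbd (lt_of_not_ge h)))
      | some i =>
        rw [simTree_succ_of_some θ w h hp]
        set T0 := simTree θ w D (restrictPoly i false p) with hT0
        set T1 := simTree θ w D (restrictPoly i true p) with hT1
        have IH0 := haltError_simTree_le hw hθ hε hAA D (restrictPoly i false p)
          ((totalDegree_restrictPoly_le i false p).trans hdeg) (restrictPoly_bound hbd i false)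
        have IH1 := haltError_simTree_le hw hθ hε hAA D (restrictPoly i true p)
          ((totalDegree_restrictPoly_le i true p).trans hdeg) (restrictPoly_bound hbd i true)
        rw [← hT0] at IH0
        rw [← hT1] at IH1
        set G0 : (Fin N → Bool) → ℝ := fun x =>
          if T0.cost x < D ∧ ε < |T0.eval x - evalBool (restrictPoly i false p) x|
            then (1 : ℝ) else 0 with hG0
        set G1 : (Fin N → Bool) → ℝ := fun x =>
          if T1.cost x < D ∧ ε < |T1.eval x - evalBool (restrictPoly i true p) x|
            then (1 : ℝ) else 0 with hG1
        have hinv0 : ∀ x, G0 (flipBit i x) = G0 x := fun x => by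
          have hf := simTree_flipBit θ w hw i D (restrictPoly i false p)
            (evalBool_restrictPoly_flipBit i false p) x
          simp only [hG0]
          rw [hf.1, hf.2, evalBool_restrictPoly_flipBit]
        have hinv1 : ∀ x, G1 (flipBit i x) = G1 x := fun x => by
          have hf := simTree_flipBit θ w hw i D (restrictPoly i true p)
            (evalBool_restrictPoly_flipBit i true p) x
          simp only [hG1]
          rw [hf.1, hf.2, evalBool_restrictPoly_flipBit]
        have hpt : ∀ x : Fin N → Bool,
            (if (RealDecisionTree.query i T0 T1).cost x < D + 1 ∧
                ε < |(RealDecisionTree.query i T0 T1).eval x - evalBool p x| then (1 : ℝ) else 0) =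
              (if x i = false then G0 x else 0) + (if x i = true then G1 x else 0) := by
          intro x
          simp only [RealDecisionTree.cost_query, RealDecisionTree.eval_query, hG0, hG1]
          by_cases hxi : x i = true
          · have hx : Function.update x i true = x := by rw [← hxi, Function.update_eq_self]
            simp [evalBool_restrictPoly, hx, hxi]
          · have hxi' : x i = false := by simpa using hxi
            have hx : Function.update x i false = x := by rw [← hxi', Function.update_eq_self]
            simp [evalBool_restrictPoly, hx, hxi']
        rw [Finset.sum_congr rfl (fun x _ => hpt x), Finset.sum_add_distrib,
          sum_ite_apply_eq_half i false hinv0, sum_ite_apply_eq_half i true hinv1]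
        nlinarith [IH0, IH1]

end SimTree

/-- The arithmetic core of the query bound `8d/(wδ) = poly(T, 1/ε, 1/δ)`: with `d ≤ 2u`,
`2θu³ ≥ 1`, `δu ≥ 1` one has `8 d^{c+1} ≤ 16·2^c·2^c · u^{4c+2} θ^c δ`. [folklore] -/
theorem queryBudget_arith (c : ℕ) {u d θ δ : ℝ} (hu : 0 ≤ u) (hd : 0 ≤ d) (hdu : d ≤ 2 * u)
    (hθu : 1 ≤ 2 * θ * u ^ 3) (hδu : 1 ≤ δ * u) :
    8 * d ^ (c + 1) ≤ 16 * 2 ^ c * 2 ^ c * u ^ (4 * c + 2) * θ ^ c * δ := by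
  calc 8 * d ^ (c + 1) ≤ 8 * (2 * u) ^ (c + 1) := by gcongr
    _ = 16 * 2 ^ c * u ^ (c + 1) * 1 * 1 := by ring
    _ ≤ 16 * 2 ^ c * u ^ (c + 1) * (2 * θ * u ^ 3) ^ c * (δ * u) := by
        gcongr
        exact one_le_pow₀ hθu
    _ = 16 * 2 ^ c * 2 ^ c * u ^ (4 * c + 2) * θ ^ c * δ := by ring

end ClassicalSimulation

/-! ### Theorem 7 (i) -/

open ClassicalSimulation in
/-- **Aaronson–Ambainis 2014, Theorem 7 (i)** (ToC version Thm. 1.8 (i) / Thm. 3.3): the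
Aaronson–Ambainis conjecture (`AAConjecture`, bounded low-degree polynomials have influential
variables) implies that every `T`-query quantum algorithm is `ε`-approximated on all but a
`δ`-fraction of the inputs by a deterministic decision tree of depth `poly(T, 1/ε, 1/δ)`
(`QuantumQuerySimulable`). Discharges the named fact `AaronsonAmbainis2014_thm7`.
[cite: AaronsonAmbainis2014, Thm. 7 (i) (= ToC Thm. 3.3)] -/
theorem AaronsonAmbainis2014_thm7_holds : AaronsonAmbainis2014_thm7 := by
  rintro ⟨c, C, hC, H⟩
  refine ⟨Nat.ceil (16 * 2 ^ c * 2 ^ c / C) + 1, 4 * c + 2, ?_⟩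
  intro N Q ε δ hε hε1 hδ hδ1
  obtain ⟨p, hdeg, hrep⟩ := exists_acceptPolynomial Q
  have hrep' : ∀ x, evalBool p x = Q.acceptProb x := fun x => (hrep x).symm
  have hbd : ∀ x, 0 ≤ evalBool p x ∧ evalBool p x ≤ 1 := fun x => by
    rw [hrep']
    exact ⟨Q.acceptProb_nonneg x, Q.acceptProb_le_one' x⟩
  set T : ℕ := Q.queries with hT
  set u : ℝ := (T : ℝ) / (ε * δ) + 1 with hu
  have hu0 : 0 < u := by positivity
  have hCk : (0 : ℝ) ≤ (Nat.ceil (16 * 2 ^ c * 2 ^ c / C) + 1 : ℕ) * u ^ (4 * c + 2) := by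
    positivity
  rcases Nat.eq_zero_or_pos T with hT0 | hTpos
  · -- `T = 0`: the acceptance probability is constant; a single leaf suffices.
    have hdeg0 : p.totalDegree = 0 := by
      rw [hT0] at hdeg
      exact Nat.le_zero.mp hdeg
    refine ⟨RealDecisionTree.leaf (cubeFourierCoeff (evalBool p) ∅), ?_, ?_⟩
    · simpa using hCk
    · have hempty : (Finset.univ.filter fun x : Fin N → Bool =>
          ε < |(RealDecisionTree.leaf (cubeFourierCoeff (evalBool p) ∅) : RealDecisionTree N).eval x
            - Q.acceptProb x|) = ∅ := by
        refine Finset.filter_eq_empty_iff.mpr fun x _ => ?_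
        rw [RealDecisionTree.eval_leaf, ← hrep' x, ← evalBool_eq_cubeFourierCoeff_empty p hdeg0 x,
          sub_self, abs_zero]
        exact not_lt.mpr hε.le
      rw [hempty, Finset.card_empty, Nat.cast_zero]
      positivity
  · -- `T ≥ 1`: run the algorithm with `d = 2T`, `θ = ε²δ/2`, `w = C (θ/d)^c`, budget `⌈8d/(wδ)⌉`.
    set d : ℕ := 2 * T with hd
    have hd1 : 1 ≤ d := by omega
    have hdpos : (0 : ℝ) < d := by exact_mod_cast hd1
    set θ : ℝ := ε ^ 2 * δ / 2 with hθ
    have hθpos : 0 < θ := by positivity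
    set w : ℝ := C * (θ / d) ^ c with hw
    have hwpos : 0 < w := by positivity
    have hAA' : ∀ q : MvPolynomial (Fin N) ℝ, q.totalDegree ≤ d →
        (∀ x, 0 ≤ evalBool q x ∧ evalBool q x ≤ 1) → θ < boolVariance q →
          ∃ i, w ≤ influence i q :=
      fun q hq hqb hθq => H N d q θ hd1 hq hqb hθpos hθq.le
    set D : ℕ := Nat.ceil (8 * d / (w * δ)) with hD
    have hDge : 8 * d / (w * δ) ≤ D := Nat.le_ceil _
    have hbudget : 0 < 8 * d / (w * δ) := by positivity
    have hDpos : (0 : ℝ) < D := lt_of_lt_of_le hbudget hDge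
    -- the size of `u = T/(εδ) + 1` relative to `T`, `1/ε`, `1/δ`, `d`, `1/θ`
    have hT1 : (1 : ℝ) ≤ T := by exact_mod_cast hTpos
    have hεδ : 0 < ε * δ := mul_pos hε hδ
    have hεδ1 : ε * δ ≤ 1 := mul_le_one₀ hε1 hδ.le hδ1
    have hprod : ε * δ * u = T + ε * δ := by
      rw [hu]
      field_simp
    have hεu : 1 ≤ ε * u := by
      have h1 : 0 ≤ ε * u * (1 - δ) := mul_nonneg (by positivity) (by linarith)
      nlinarith
    have hδu : 1 ≤ δ * u := by
      have h1 : 0 ≤ δ * u * (1 - ε) := mul_nonneg (by positivity) (by linarith)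
      nlinarith
    have hTu : (T : ℝ) ≤ u := by
      have h1 : 0 ≤ u * (1 - ε * δ) := mul_nonneg hu0.le (by linarith)
      nlinarith
    have hdu : (d : ℝ) ≤ 2 * u := by
      rw [hd]
      push_cast
      linarith
    have hθu : 1 ≤ 2 * θ * u ^ 3 := by
      have : 2 * θ * u ^ 3 = (ε * u) ^ 2 * (δ * u) := by
        rw [hθ]
        ring
      rw [this]
      exact one_le_mul_of_one_le_of_one_le (one_le_pow₀ hεu) hδu
    have hK : 8 * (d : ℝ) / (w * δ) ≤ 16 * 2 ^ c * 2 ^ c / C * u ^ (4 * c + 2) := by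
      rw [div_le_iff₀ (by positivity)]
      have hC0 : C ≠ 0 := hC.ne'
      have hd0 : (d : ℝ) ≠ 0 := hdpos.ne'
      have hwδ : 16 * 2 ^ c * 2 ^ c / C * u ^ (4 * c + 2) * (w * δ) =
          16 * 2 ^ c * 2 ^ c * u ^ (4 * c + 2) * θ ^ c * δ / (d : ℝ) ^ c := by
        rw [hw, div_pow]
        field_simp
      rw [hwδ, le_div_iff₀ (by positivity)]
      calc 8 * (d : ℝ) * (d : ℝ) ^ c = 8 * (d : ℝ) ^ (c + 1) := by ring
        _ ≤ _ := queryBudget_arith c hu0.le hdpos.le hdu hθu hδu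
    set t := simTree θ w D p with ht
    refine ⟨t, ?_, ?_⟩
    · -- the number of queries
      have hu1 : (1 : ℝ) ≤ u ^ (4 * c + 2) := one_le_pow₀ (by linarith)
      have hceil : 16 * 2 ^ c * 2 ^ c / C ≤ (Nat.ceil (16 * 2 ^ c * 2 ^ c / C) : ℝ) :=
        Nat.le_ceil _
      calc (t.depth : ℝ) ≤ D := by exact_mod_cast depth_simTree_le θ w D p
        _ ≤ 8 * d / (w * δ) + 1 := (Nat.ceil_lt_add_one hbudget.le).le
        _ ≤ 16 * 2 ^ c * 2 ^ c / C * u ^ (4 * c + 2) + 1 := by linarith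
        _ ≤ (Nat.ceil (16 * 2 ^ c * 2 ^ c / C) + 1 : ℕ) * u ^ (4 * c + 2) := by
            have h := mul_le_mul_of_nonneg_right hceil (zero_le_one.trans hu1)
            push_cast
            linarith
    · -- the error bound: bad inputs either halt early and err, or exhaust the budget
      have hA := sum_cost_simTree_mul_le θ w d hwpos hAA' D p hdeg hbd
      have hB := haltError_simTree_le θ w d ε hwpos hθpos.le hε hAA' D p hdeg hbd
      have hM := t.markov_cost D
      rw [← ht] at hA hB
      have hI : ∑ j, influence j p ≤ 4 * d := sum_influence_le hdeg hbd
      -- pointwise: bad ⇒ (halted early and bad) or (budget exhausted)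
      have hpt : ∀ x, (if ε < |t.eval x - Q.acceptProb x| then (1 : ℝ) else 0) ≤
          (if t.cost x < D ∧ ε < |t.eval x - evalBool p x| then (1 : ℝ) else 0) +
            (if t.cost x = D then (1 : ℝ) else 0) := by
        intro x
        rw [← hrep' x]
        have hc : t.cost x ≤ D := cost_simTree_le θ w D p x
        rcases hc.lt_or_eq with hlt | heq
        · by_cases hb : ε < |t.eval x - evalBool p x| <;> simp [hlt, hlt.ne, hb]
        · by_cases hb : ε < |t.eval x - evalBool p x| <;> simp [heq, hb]
      have hcard : ((Finset.univ.filter fun x : Fin N → Bool =>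
          ε < |t.eval x - Q.acceptProb x|).card : ℝ) =
            ∑ x, (if ε < |t.eval x - Q.acceptProb x| then (1 : ℝ) else 0) := by
        rw [Finset.natCast_card_filter]
      rw [hcard]
      -- the two failure counts
      set S1 : ℝ := ∑ x, (if t.cost x < D ∧ ε < |t.eval x - evalBool p x| then (1 : ℝ) else 0)
        with hS1
      set S2 : ℝ := ∑ x, (if t.cost x = D then (1 : ℝ) else 0) with hS2
      have hsum : ∑ x, (if ε < |t.eval x - Q.acceptProb x| then (1 : ℝ) else 0) ≤ S1 + S2 := by
        rw [hS1, hS2, ← Finset.sum_add_distrib]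
        exact Finset.sum_le_sum fun x _ => hpt x
      have h1 : S1 ≤ 2 ^ N * (δ / 2) := by
        -- `S1 ε² ≤ 2^N θ = 2^N ε² δ/2`
        have hε2 : 0 < ε ^ 2 := by positivity
        have : S1 * ε ^ 2 ≤ 2 ^ N * (δ / 2) * ε ^ 2 := by
          calc S1 * ε ^ 2 ≤ 2 ^ N * θ := hB
            _ = 2 ^ N * (δ / 2) * ε ^ 2 := by rw [hθ]; ring
        exact le_of_mul_le_mul_right this hε2
      have h2 : S2 ≤ 2 ^ N * (δ / 2) := by
        -- `D · S2 ≤ ∑ cost ≤ 2^N Inf[p]/w ≤ 2^N 4d/w` and `D ≥ 8d/(wδ)`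
        have hS2D : (D : ℝ) * S2 * w ≤ 2 ^ N * (4 * d) := by
          calc (D : ℝ) * S2 * w ≤ (∑ x, (t.cost x : ℝ)) * w :=
                mul_le_mul_of_nonneg_right hM hwpos.le
            _ ≤ 2 ^ N * ∑ j, influence j p := hA
            _ ≤ 2 ^ N * (4 * d) := by gcongr
        have hDw : 8 * d ≤ (D : ℝ) * (w * δ) := (div_le_iff₀ (by positivity)).mp hDge
        have hS2nn : 0 ≤ S2 := Finset.sum_nonneg fun x _ => by positivity
        have h3 : 8 * (d : ℝ) * S2 ≤ (D : ℝ) * (w * δ) * S2 := mul_le_mul_of_nonneg_right hDw hS2nn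
        have h5 : (D : ℝ) * S2 * w * δ ≤ 2 ^ N * (4 * d) * δ :=
          mul_le_mul_of_nonneg_right hS2D hδ.le
        have h7 : S2 * (8 * d) ≤ 2 ^ N * (δ / 2) * (8 * d) := by linarith
        exact le_of_mul_le_mul_right h7 (by positivity)
      linarith

end Literature.Computability.QuantumComplexity
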